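import Summits.CriticalPhenomena.PercolationContinuityZ3.Theorems.Transplant.SkelPhiStepIDataNS
import Summits.CriticalPhenomena.PercolationContinuityZ3.Theorems.Transplant.PlanarSkeletonFrmFromDefs
import Summits.CriticalPhenomena.PercolationContinuityZ3.Theorems.Transplant.PlanarSkeletonFrmDefs
import Summits.CriticalPhenomena.PercolationContinuityZ3.Theorems.Transplant.SkelNeg1ChoiceO
import Summits.CriticalPhenomena.PercolationContinuityZ3.Theorems.Transplant.SkelPhiParamsSched
import HarnessLib
import Summits.CriticalPhenomena.PercolationContinuityZ3.Theorems.Transplant.SkelFrm1SlotTypes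
/-!
# U-WAVE PORT (RULING D-U, lead g21 2026-08-26; WAVE-U-MANIFEST v3.0 row «SkelFrm1SlotTypes» ↦ «SkelFrmFrom1SlotTypes») of the tree module
# `Transplant/SkelFrm1SlotTypes` onto the carrier `PlanarSkeletonFrmFrom` (frames only, cylinders connected from width `ℓ₀` on)

ORIGINAL TITLE: N2 (frames-only node `SamePDropOfSkeletonFrm₁`, OPEN) — (ζ″) ledger VOCABULARY over `PlanarSkeletonFrm` ((R-20), p3-g14 2026-08-22T18:03:54Z):

builds on p205010 (kernel theorem, internal audit signed; external expert review pending) — nothing in this file uses p205010; NOTHING is claimed about the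
OPEN node U `SamePDropOfSkeletonFrmFrom₁` (nor U_s / the end state).  Lane `prim-bschramm`, seat `prim-bschramm-p3` gen 26; helper file
(`--supports stmt-CriticalPhenomena-4575 --as helper`).  PORT RULES r1–r4 of RULING D-U: declaration order and proof texts are those of the original,
byte-identical except (i) the carrier token `PlanarSkeletonFrm ↦ PlanarSkeletonFrmFrom` (binders, `namespace`/`end` lines, qualified names of twinned
declarations), (ii) carrier-FREE declarations of the original (φ-level `Skelφ…` blocks and namespace-only arithmetic residents) are NOT re-declared —
this file imports the original and `export`s the twin-free residents (POLICY T / treatment (m1)); residents whose statement mentions a twinned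
constant are copied, (iii) every carrier-binding declaration keeps its explicit binder `(Φ : PlanarSkeletonFrmFrom G)` in its own signature (r2).  Docstrings and citations are the original's.
-/

noncomputable section

namespace Summit.CriticalPhenomena.PercolationContinuityZ3.Theorems.Transplant

open Literature.Probability.Percolation Literature.Probability.LatticeModels SimpleGraph
open SkelConc (Consts)

/-! ## §1 The slot types over `Frm` / `DataNS` -/

namespace PlanarSkeletonFrmFrom

namespace Neg

/-- **A width-slot over `Frm`**: the value of the clearance floor `f` of `Neg.nL` as a function of everything p-fixed (constants, skeleton, base vertex, density,
merged record WITH its selectors). Twin of N1's `PlanarSkeletonNeg.Neg.FSlot`. [this work] -/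
def FSlot : Type 1 :=
  ∀ (κ : Consts) {V : Type} [DecidableEq V] [Countable V] {G : SimpleGraph V} [G.LocallyFinite], PlanarSkeletonFrmFrom G → V → unitInterval → Skelφ.StepI.DataNS V → ℕ

/-- **A schedule-input slot over `Frm`** (width clearance, running density): the q-level fibre block `SchedIn`. Twin of N1's `PlanarSkeletonNeg.Neg.SSlot`. [this work] -/
def SSlot : Type 1 :=
  ∀ (κ : Consts) {V : Type} [DecidableEq V] [Countable V] {G : SimpleGraph V} [G.LocallyFinite],
    PlanarSkeletonFrmFrom G → V → unitInterval → Skelφ.StepI.DataNS V → ℕ → unitInterval → Skelφ.Prm.SchedIn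

end Neg

namespace NegB

/-- **A pair slot over `Frm`**: a finite set of EXTRA admissible pairs `(M, n)` as a function of the p-fixed data, bundled with its admissibility (read off the
record's thresholds `M₀`, `n₁`). Twin of N1's `PlanarSkeletonNeg.NegB.PSlot`. [this work] -/
def PSlot : Type 1 :=
  ∀ (κ : Consts) {V : Type} [DecidableEq V] [Countable V] {G : SimpleGraph V} [G.LocallyFinite], PlanarSkeletonFrmFrom G → V → unitInterval →
    ∀ D : Skelφ.StepI.DataNS V, {S : Finset (ℕ × ℕ) // ∀ q ∈ S, D.M₀ ≤ q.1 ∧ D.n₁ q.1 ≤ q.2}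

/-- The empty pair slot over `Frm`. [folklore] -/
def PSlot.empty : PSlot := fun _ _ _ _ _ _ _ _ _ _ => ⟨∅, fun _ h => absurd h (Finset.notMem_empty _)⟩

/-- **A schedule-input slot over `Frm`** (box slot, width slot, running density): the q-level fibre block `SchedIn`. Twin of N1's `PlanarSkeletonNeg.NegB.SSlot`. [this work] -/
def SSlot : Type 1 :=
  ∀ (κ : Consts) {V : Type} [DecidableEq V] [Countable V] {G : SimpleGraph V} [G.LocallyFinite],
    PlanarSkeletonFrmFrom G → V → unitInterval → Skelφ.StepI.DataNS V → ℕ → ℕ → unitInterval → Skelφ.Prm.SchedIn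

end NegB

end PlanarSkeletonFrmFrom

/-! ## §2 The Step-I‴ output record as the ledger reads it -/

namespace Skelφ.StepI

variable {V : Type}

end Skelφ.StepI

end Summit.CriticalPhenomena.PercolationContinuityZ3.Theorems.Transplant

end
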